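import Summits.NavierStokesRegularity.NavierStokesRegularity.Theorems.RellichScarSymmetricScarExistsPeriodicWorld

/-!
# Crux `SymmetricScarExists` (stmt-NavierStokesRegularity-11718), line `logtime-bernoulli-certificate`:
# the WEAKEST bet `stub_oneGoodSlice` is false in the periodic world as well

Refuter's negative lemma (drefute gen 2; `--supports stmt-NavierStokesRegularity-11718`; theorems
only, no definitions, no named facts).  The lead's `…PeriodicWorld.lean` certifies that ONE
time-periodic non-steady eternal profile in the weighted class `LB(C, K)` refutes the two STRONGER
registered bet statements (`stub_finiteGaussianAction`, `stub_logtimeBernoulliCertificate`).  Here the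
same is proved for the weakest registered form, `stub_oneGoodSlice` ("for every `δ, R > 0` some slice
has self-similar defect `‖∂ₛU‖ ≤ δ` on `B_R`"), which is the form the composition actually consumes:

* `not_oneGoodSlice_of_periodic`: an `L`-periodic (`L > 0`) classical solution of the backward Leray
  system NONE OF WHOSE SLICES IS A STEADY (Leray) PROFILE — `∀ s, ∃ y, ∂ₛU(s, y) ≠ 0` — has no family
  of good slices: by periodicity the good slices may be taken in `[0, L]`, a subsequence converges
  (Bolzano–Weierstrass), and joint continuity of `∂ₛU` makes the limit slice steady.
* `not_oneGoodSliceStatement_of_periodic_world'`: hence the registered statement of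
  `stub_oneGoodSlice` is FALSE in any world containing one such profile in `LB(C, K)`.
* `steady_of_stationary_slice` + `not_oneGoodSliceStatement_of_periodic_world`: the hypothesis
  "no slice is steady" follows from the lead's weaker non-steadiness `∃ s₀ y₀, ∂ₛU(s₀, y₀) ≠ 0` under
  FORWARD UNIQUENESS in the class `LB(C, K)` (stated inline; classical bounded decaying solutions with
  Riesz pressure are mild and mild bounded solutions are unique — known, not yet in the tree): a steady
  slice `U(s⋆)` is itself a member of `LB(C, K)` as a constant trajectory, so uniqueness forward of `s⋆`
  plus periodicity would make `U` constant.

So all three registered strengths of the bet (3 ⇒ 4 ⇒ 4′) stand or fall together with the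
non-existence of periodic (λ-DSS, `L = 2 log λ`) non-steady apex Leray profiles — Bradshaw–Tsai 2017
OP 5.1 / Chae–Wolf 2017 Thm 1.3 (only `λ` near `1` excluded).  No `sorry`.
-/

noncomputable section

open Set Metric Function Filter MeasureTheory Topology
open scoped ContDiff

namespace Summit.NavierStokesRegularity.NavierStokesRegularity.Theorems.SymmetricScarExists.Negative

set_option linter.dupNamespace false

open Literature.Analysis.FluidPDE Literature.Analysis.FluidPDE.PineauVicol2026
open Summit.NavierStokesRegularity.NavierStokesRegularity.Theorems.SymmetricScarExists.LogtimeBernoulli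

variable {U : ℝ → EuclideanSpace ℝ (Fin 3) → EuclideanSpace ℝ (Fin 3)} {P : ℝ → EuclideanSpace ℝ (Fin 3) → ℝ}

/-- The self-similar defect `∂ₛU` of a classical solution of the backward Leray system on `ℝ` is
jointly continuous in `(s, y)`. [folklore] -/
theorem continuous_uncurry_timeDerivWithin (hsol : IsBackwardLeraySolutionOn (univ : Set ℝ) 1 U P) :
    Continuous (uncurry (timeDerivWithin (univ : Set ℝ) U)) := by
  have hV : IsSmoothSpaceTimeOn (univ : Set ℝ) (timeDerivWithin (univ : Set ℝ) U) :=
    hsol.smooth_velocity.timeDerivWithin uniqueDiffOn_univ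
  have := hV.continuousOn
  rwa [univ_prod_univ, continuousOn_univ] at this

/-- **A periodic eternal Leray profile none of whose slices is steady has no family of good slices.**
If `(U, P)` solves the backward Leray system classically on `ℝ`, is `L`-periodic in `s` (`L > 0`) and
every slice has a point where `∂ₛU ≠ 0`, then it is FALSE that for every `δ, R > 0` some slice has
`‖∂ₛU(s̄, y)‖ ≤ δ` on `B_R`: reduce the good slices modulo `L` into `[0, L]`, extract a convergent
subsequence, and pass to the limit in the jointly continuous `∂ₛU`. [folklore] -/
theorem not_oneGoodSlice_of_periodic {L : ℝ}
    (hsol : IsBackwardLeraySolutionOn (univ : Set ℝ) 1 U P)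
    (hL : 0 < L) (hper : ∀ s y, U (s + L) y = U s y)
    (hne : ∀ s : ℝ, ∃ y : EuclideanSpace ℝ (Fin 3), timeDerivWithin (univ : Set ℝ) U s y ≠ 0) :
    ¬ ∀ δ : ℝ, 0 < δ → ∀ R : ℝ, 0 < R → ∃ sbar : ℝ, ∀ y : EuclideanSpace ℝ (Fin 3), ‖y‖ < R →
        ‖timeDerivWithin (univ : Set ℝ) U sbar y‖ ≤ δ := by
  intro h
  -- good slices at accuracy `1/(n+1)` on the ball of radius `n+1`
  have hpos : ∀ n : ℕ, (0 : ℝ) < 1 / ((n : ℝ) + 1) := fun n => by positivity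
  choose sbar hsbar using fun n : ℕ => h (1 / ((n : ℝ) + 1)) (hpos n) ((n : ℝ) + 1) (by positivity)
  -- the defect is `L`-periodic in `s`, so the slices may be reduced into `[0, L)`
  have hFper : ∀ y, Periodic (fun s => timeDerivWithin (univ : Set ℝ) U s y) L := fun y s =>
    timeDerivWithin_univ_periodic hper s y
  set s' : ℕ → ℝ := fun n => toIcoMod hL 0 (sbar n) with hs'
  have hs'eq : ∀ n y, timeDerivWithin (univ : Set ℝ) U (s' n) y = timeDerivWithin (univ : Set ℝ) U (sbar n) y := by
    intro n y
    have e : s' n = sbar n - toIcoDiv hL 0 (sbar n) • L := (self_sub_toIcoDiv_zsmul hL 0 (sbar n)).symm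
    rw [e]
    exact (hFper y).sub_zsmul_eq (toIcoDiv hL 0 (sbar n))
  have hmem : ∀ n, s' n ∈ Icc (0 : ℝ) L := fun n => by
    have hm := toIcoMod_mem_Ico hL 0 (sbar n)
    rw [zero_add] at hm
    exact Ico_subset_Icc_self hm
  -- Bolzano–Weierstrass
  obtain ⟨sstar, -, φ, hφ, hlim⟩ := tendsto_subseq_of_bounded (isBounded_Icc (0 : ℝ) L) hmem
  -- the limit slice is steady
  have hc := continuous_uncurry_timeDerivWithin hsol
  have hzero : ∀ y, timeDerivWithin (univ : Set ℝ) U sstar y = 0 := by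
    intro y
    have hcy : Continuous fun s => timeDerivWithin (univ : Set ℝ) U s y :=
      hc.comp (continuous_id.prodMk continuous_const)
    have hT : Tendsto (fun n => ‖timeDerivWithin (univ : Set ℝ) U (s' (φ n)) y‖) atTop
        (𝓝 ‖timeDerivWithin (univ : Set ℝ) U sstar y‖) :=
      ((continuous_norm.comp hcy).tendsto sstar).comp hlim
    have hB : Tendsto (fun n => 1 / (((φ n : ℕ) : ℝ) + 1)) atTop (𝓝 0) :=
      tendsto_one_div_add_atTop_nhds_zero_nat.comp hφ.tendsto_atTop
    have hev : ∀ᶠ n in atTop, ‖timeDerivWithin (univ : Set ℝ) U (s' (φ n)) y‖ ≤ 1 / (((φ n : ℕ) : ℝ) + 1) := by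
      obtain ⟨N, hN⟩ := exists_nat_gt ‖y‖
      refine eventually_atTop.2 ⟨N, fun n hn => ?_⟩
      rw [hs'eq]
      refine hsbar (φ n) y ?_
      have h1 : (N : ℝ) ≤ (φ n : ℕ) := by exact_mod_cast hn.trans (hφ.id_le n)
      linarith
    have hle : ‖timeDerivWithin (univ : Set ℝ) U sstar y‖ ≤ 0 := le_of_tendsto_of_tendsto hT hB hev
    exact norm_le_zero_iff.1 hle
  obtain ⟨y, hy⟩ := hne sstar
  exact hy (hzero y)


/-- **The registered statement of `stub_oneGoodSlice` is FALSE in any world containing ONE periodic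
eternal profile in the weighted class `LB(C, K)` none of whose slices is steady** (a backward `λ`-DSS,
non-self-similar Type-I blow-up profile, `L = 2 log λ`: Bradshaw–Tsai 2017 OP 5.1, open; Chae–Wolf
2017 Thm 1.3 excludes only `λ` near `1`).  Primed form: "no steady slice" assumed directly; see
`not_oneGoodSliceStatement_of_periodic_world` for the lead's non-steadiness `∃ s₀ y₀` plus forward
uniqueness. [cite: ChaeWolf2017RemovingDSS, Thm 1.3 and §4] -/
theorem not_oneGoodSliceStatement_of_periodic_world'
    (hworld : ∃ (C K L : ℝ) (U : ℝ → EuclideanSpace ℝ (Fin 3) → EuclideanSpace ℝ (Fin 3)) (P : ℝ → EuclideanSpace ℝ (Fin 3) → ℝ),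
      (Literature.Analysis.FluidPDE.IsBackwardLeraySolutionOn (Set.univ : Set ℝ) 1 U P ∧ ∀ (s : ℝ) (y : EuclideanSpace ℝ (Fin 3)), (1 + ‖y‖) * ‖U s y‖ ≤ C ∧ (1 + ‖y‖) ^ 2 * ‖fderiv ℝ (U s) y‖ ≤ K ∧ (1 + ‖y‖) ^ 3 * ‖iteratedFDeriv ℝ 2 (U s) y‖ ≤ K ∧ (1 + ‖y‖) ^ 2 * |P s y| ≤ K ∧ (1 + ‖y‖) ^ 3 * ‖gradient (P s) y‖ ≤ K ∧ (1 + ‖y‖) * ‖Literature.Analysis.FluidPDE.timeDerivWithin (Set.univ : Set ℝ) U s y‖ ≤ K ∧ (1 + ‖y‖) ^ 2 * ‖fderiv ℝ (fun z => Literature.Analysis.FluidPDE.timeDerivWithin (Set.univ : Set ℝ) U s z) y‖ ≤ K ∧ (1 + ‖y‖) ^ 3 * ‖Literature.Analysis.FluidPDE.timeDerivWithin (Set.univ : Set ℝ) U s y + (1 / 2 : ℝ) • U s y + (1 / 2 : ℝ) • fderiv ℝ (U s) y y‖ ≤ K) ∧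
      0 < L ∧ (∀ s y, U (s + L) y = U s y) ∧
      ∀ s : ℝ, ∃ y : EuclideanSpace ℝ (Fin 3), timeDerivWithin (univ : Set ℝ) U s y ≠ 0) :
    ¬ (∀ (C K : ℝ) (U : ℝ → EuclideanSpace ℝ (Fin 3) → EuclideanSpace ℝ (Fin 3)) (P : ℝ → EuclideanSpace ℝ (Fin 3) → ℝ), (Literature.Analysis.FluidPDE.IsBackwardLeraySolutionOn (Set.univ : Set ℝ) 1 U P ∧ ∀ (s : ℝ) (y : EuclideanSpace ℝ (Fin 3)), (1 + ‖y‖) * ‖U s y‖ ≤ C ∧ (1 + ‖y‖) ^ 2 * ‖fderiv ℝ (U s) y‖ ≤ K ∧ (1 + ‖y‖) ^ 3 * ‖iteratedFDeriv ℝ 2 (U s) y‖ ≤ K ∧ (1 + ‖y‖) ^ 2 * |P s y| ≤ K ∧ (1 + ‖y‖) ^ 3 * ‖gradient (P s) y‖ ≤ K ∧ (1 + ‖y‖) * ‖Literature.Analysis.FluidPDE.timeDerivWithin (Set.univ : Set ℝ) U s y‖ ≤ K ∧ (1 + ‖y‖) ^ 2 * ‖fderiv ℝ (fun z => Literature.Analysis.FluidPDE.timeDerivWithin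 (Set.univ : Set ℝ) U s z) y‖ ≤ K ∧ (1 + ‖y‖) ^ 3 * ‖Literature.Analysis.FluidPDE.timeDerivWithin (Set.univ : Set ℝ) U s y + (1 / 2 : ℝ) • U s y + (1 / 2 : ℝ) • fderiv ℝ (U s) y y‖ ≤ K) → ∀ δ : ℝ, 0 < δ → ∀ R : ℝ, 0 < R → (∃ sbar : ℝ, ∀ y : EuclideanSpace ℝ (Fin 3), ‖y‖ < R → ‖Literature.Analysis.FluidPDE.timeDerivWithin (Set.univ : Set ℝ) U sbar y‖ ≤ δ)) := by
  intro hstub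
  obtain ⟨C, K, L, U, P, hLB, hL, hper, hne⟩ := hworld
  exact not_oneGoodSlice_of_periodic hLB.1 hL hper hne (hstub C K U P hLB)

/-- **A stationary slice is a steady member of the class.**  If `(U, P) ∈ LB(C, K)` and the slice
`s⋆` is stationary, `∂ₛU(s⋆, ·) ≡ 0`, then the constant trajectory `(U(s⋆), P(s⋆))` is again a member
of `LB(C, K)` (it solves the backward Leray system — i.e. `U(s⋆)` is a Leray profile — and inherits
the weighted bounds, its own defect being `0 ≤ K`). [folklore] -/
theorem const_mem_of_stationary_slice {C K : ℝ} (hLB : (Literature.Analysis.FluidPDE.IsBackwardLeraySolutionOn (Set.univ : Set ℝ) 1 U P ∧ ∀ (s : ℝ) (y : EuclideanSpace ℝ (Fin 3)), (1 + ‖y‖) * ‖U s y‖ ≤ C ∧ (1 + ‖y‖) ^ 2 * ‖fderiv ℝ (U s) y‖ ≤ K ∧ (1 + ‖y‖) ^ 3 * ‖iteratedFDeriv ℝ 2 (U s) y‖ ≤ K ∧ (1 + ‖y‖) ^ 2 * |P s y| ≤ K ∧ (1 + ‖y‖) ^ 3 * ‖gradient (P s) y‖ ≤ K ∧ (1 +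 ‖y‖) * ‖Literature.Analysis.FluidPDE.timeDerivWithin (Set.univ : Set ℝ) U s y‖ ≤ K ∧ (1 + ‖y‖) ^ 2 * ‖fderiv ℝ (fun z => Literature.Analysis.FluidPDE.timeDerivWithin (Set.univ : Set ℝ) U s z) y‖ ≤ K ∧ (1 + ‖y‖) ^ 3 * ‖Literature.Analysis.FluidPDE.timeDerivWithin (Set.univ : Set ℝ) U s y + (1 / 2 : ℝ) • U s y + (1 / 2 : ℝ) • fderiv ℝ (U s) y y‖ ≤ K)) {sstar : ℝ}
    (hst : ∀ y, timeDerivWithin (univ : Set ℝ) U sstar y = 0) :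
    (Literature.Analysis.FluidPDE.IsBackwardLeraySolutionOn (Set.univ : Set ℝ) 1 (fun (_ : ℝ) (x : EuclideanSpace ℝ (Fin 3)) => U sstar x) (fun (_ : ℝ) (x : EuclideanSpace ℝ (Fin 3)) => P sstar x) ∧ ∀ (s : ℝ) (y : EuclideanSpace ℝ (Fin 3)), (1 + ‖y‖) * ‖(fun (_ : ℝ) (x : EuclideanSpace ℝ (Fin 3)) => U sstar x) s y‖ ≤ C ∧ (1 + ‖y‖) ^ 2 * ‖fderiv ℝ ((fun (_ : ℝ) (x : EuclideanSpace ℝ (Fin 3)) => U sstar x) s) y‖ ≤ K ∧ (1 + ‖y‖) ^ 3 * ‖iteratedFDeriv ℝ 2 ((fun (_ : ℝ) (x : EuclideanSpace ℝ (Fin 3)) => U sstar x) s) y‖ ≤ K ∧ (1 + ‖y‖) ^ 2 * |(fun (_ : ℝ) (x : EuclideanSpace ℝ (Fin 3)) => P sstar x) s y| ≤ K ∧ (1 + ‖y‖) ^ 3 * ‖gradient ((fun (_ : ℝ) (x : EuclideanSpace ℝ (Fin 3)) => P sstar x) s) y‖ ≤ K ∧ (1 + ‖y‖) * ‖Literature.Analysis.FluidPDE.timeDerivWithin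 (Set.univ : Set ℝ) (fun (_ : ℝ) (x : EuclideanSpace ℝ (Fin 3)) => U sstar x) s y‖ ≤ K ∧ (1 + ‖y‖) ^ 2 * ‖fderiv ℝ (fun z => Literature.Analysis.FluidPDE.timeDerivWithin (Set.univ : Set ℝ) (fun (_ : ℝ) (x : EuclideanSpace ℝ (Fin 3)) => U sstar x) s z) y‖ ≤ K ∧ (1 + ‖y‖) ^ 3 * ‖Literature.Analysis.FluidPDE.timeDerivWithin (Set.univ : Set ℝ) (fun (_ : ℝ) (x : EuclideanSpace ℝ (Fin 3)) => U sstar x) s y + (1 / 2 : ℝ) • (fun (_ : ℝ) (x : EuclideanSpace ℝ (Fin 3)) => U sstar x) s y + (1 / 2 : ℝ) • fderiv ℝ ((fun (_ : ℝ) (x : EuclideanSpace ℝ (Fin 3)) => U sstar x) s) y y‖ ≤ K) := by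
  obtain ⟨hsol, hbd⟩ := hLB
  have hD : ∀ s y, timeDerivWithin (univ : Set ℝ) (fun (_ : ℝ) (x : EuclideanSpace ℝ (Fin 3)) => U sstar x) s y = 0 :=
    fun s y => by simp only [timeDerivWithin_apply, derivWithin_fun_const, Pi.zero_apply]
  have hK : 0 ≤ K := le_trans (by positivity) (hbd sstar 0).2.1
  refine ⟨?_, fun s y => ?_⟩
  · have hUs : ContDiff ℝ ∞ (U sstar) := hsol.smooth_velocity.contDiff_slice (mem_univ sstar)
    have hPs : ContDiff ℝ ∞ (P sstar) := hsol.smooth_pressure.contDiff_slice (mem_univ sstar)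
    exact
      { smooth_velocity := (hUs.comp contDiff_snd).contDiffOn
        smooth_pressure := (hPs.comp contDiff_snd).contDiffOn
        momentum := fun s _ y => by
          have hm := hsol.momentum sstar (mem_univ _) y
          rw [hst y] at hm
          rw [hD s y]
          simpa only [rescaledEulerLerayForce_apply] using hm
        divFree := fun s _ => hsol.divFree sstar (mem_univ _) }
  · obtain ⟨b1, b2, b3, b4, b5, -, -, b8⟩ := hbd sstar y
    refine ⟨b1, b2, b3, b4, b5, ?_, ?_, ?_⟩
    · rw [hD, norm_zero, mul_zero]; exact hK
    · have : (fun z => timeDerivWithin (univ : Set ℝ) (fun (_ : ℝ) (x : EuclideanSpace ℝ (Fin 3)) => U sstar x) s z) = fun _ => 0 :=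
        funext fun z => hD s z
      rw [this, fderiv_const_apply, norm_zero, mul_zero]; positivity
    · rw [hD, zero_add]
      rw [hst y, zero_add] at b8
      exact b8

/-- **In the lead's periodic world, forward uniqueness in `LB(C, K)` leaves no steady slice.**  If
`(U, P) ∈ LB(C, K)` is `L`-periodic and not steady (`∂ₛU(s₀, y₀) ≠ 0` somewhere), and trajectories in
`LB(C, K)` are determined by a slice forward in `s` (classical bounded decaying solutions with Riesz
pressure are mild, and bounded mild solutions are unique — known mathematics, stated inline), then
EVERY slice has a point with `∂ₛU ≠ 0`: a stationary slice `s⋆` would be a steady member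
(`const_mem_of_stationary_slice`), uniqueness forward of `s⋆` and periodicity would make `U` constant
in `s`, hence steady. [folklore] -/
theorem forall_exists_timeDerivWithin_ne_zero_of_forwardUnique {C K L : ℝ} (hLB : (Literature.Analysis.FluidPDE.IsBackwardLeraySolutionOn (Set.univ : Set ℝ) 1 U P ∧ ∀ (s : ℝ) (y : EuclideanSpace ℝ (Fin 3)), (1 + ‖y‖) * ‖U s y‖ ≤ C ∧ (1 + ‖y‖) ^ 2 * ‖fderiv ℝ (U s) y‖ ≤ K ∧ (1 + ‖y‖) ^ 3 * ‖iteratedFDeriv ℝ 2 (U s) y‖ ≤ K ∧ (1 + ‖y‖) ^ 2 * |P s y| ≤ K ∧ (1 + ‖y‖) ^ 3 * ‖gradient (P s) y‖ ≤ K ∧ (1 + ‖y‖) * ‖Literature.Analysis.FluidPDE.timeDerivWithin (Set.univ : Set ℝ) U s y‖ ≤ K ∧ (1 + ‖y‖) ^ 2 * ‖fderiv ℝ (fun z => Literature.Analysis.FluidPDE.timeDerivWithin (Set.univ : Set ℝ) U s z) y‖ ≤ K ∧ (1 + ‖y‖) ^ 3 * ‖Literature.Analysis.FluidPDE.timeDerivWithin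 (Set.univ : Set ℝ) U s y + (1 / 2 : ℝ) • U s y + (1 / 2 : ℝ) • fderiv ℝ (U s) y y‖ ≤ K))
    (huniq : ∀ (U₁ : ℝ → EuclideanSpace ℝ (Fin 3) → EuclideanSpace ℝ (Fin 3)) (P₁ : ℝ → EuclideanSpace ℝ (Fin 3) → ℝ)
      (U₂ : ℝ → EuclideanSpace ℝ (Fin 3) → EuclideanSpace ℝ (Fin 3)) (P₂ : ℝ → EuclideanSpace ℝ (Fin 3) → ℝ),
      (Literature.Analysis.FluidPDE.IsBackwardLeraySolutionOn (Set.univ : Set ℝ) 1 U₁ P₁ ∧ ∀ (s : ℝ) (y : EuclideanSpace ℝ (Fin 3)), (1 + ‖y‖) * ‖U₁ s y‖ ≤ C ∧ (1 + ‖y‖) ^ 2 * ‖fderiv ℝ (U₁ s) y‖ ≤ K ∧ (1 + ‖y‖) ^ 3 * ‖iteratedFDeriv ℝ 2 (U₁ s) y‖ ≤ K ∧ (1 + ‖y‖) ^ 2 * |P₁ s y| ≤ K ∧ (1 + ‖y‖) ^ 3 * ‖gradient (P₁ s) y‖ ≤ K ∧ (1 + ‖y‖) * ‖Literature.Analysis.FluidPDE.timeDerivWithin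 (Set.univ : Set ℝ) U₁ s y‖ ≤ K ∧ (1 + ‖y‖) ^ 2 * ‖fderiv ℝ (fun z => Literature.Analysis.FluidPDE.timeDerivWithin (Set.univ : Set ℝ) U₁ s z) y‖ ≤ K ∧ (1 + ‖y‖) ^ 3 * ‖Literature.Analysis.FluidPDE.timeDerivWithin (Set.univ : Set ℝ) U₁ s y + (1 / 2 : ℝ) • U₁ s y + (1 / 2 : ℝ) • fderiv ℝ (U₁ s) y y‖ ≤ K) → (Literature.Analysis.FluidPDE.IsBackwardLeraySolutionOn (Set.univ : Set ℝ) 1 U₂ P₂ ∧ ∀ (s : ℝ) (y : EuclideanSpace ℝ (Fin 3)), (1 + ‖y‖) * ‖U₂ s y‖ ≤ C ∧ (1 + ‖y‖) ^ 2 * ‖fderiv ℝ (U₂ s) y‖ ≤ K ∧ (1 + ‖y‖) ^ 3 * ‖iteratedFDeriv ℝ 2 (U₂ s) y‖ ≤ K ∧ (1 + ‖y‖) ^ 2 * |P₂ s y| ≤ K ∧ (1 + ‖y‖) ^ 3 * ‖gradient (P₂ s) y‖ ≤ K ∧ (1 + ‖y‖) * ‖Literature.Analysis.FluidPDE.timeDerivWithin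 (Set.univ : Set ℝ) U₂ s y‖ ≤ K ∧ (1 + ‖y‖) ^ 2 * ‖fderiv ℝ (fun z => Literature.Analysis.FluidPDE.timeDerivWithin (Set.univ : Set ℝ) U₂ s z) y‖ ≤ K ∧ (1 + ‖y‖) ^ 3 * ‖Literature.Analysis.FluidPDE.timeDerivWithin (Set.univ : Set ℝ) U₂ s y + (1 / 2 : ℝ) • U₂ s y + (1 / 2 : ℝ) • fderiv ℝ (U₂ s) y y‖ ≤ K) → ∀ s₀ : ℝ, U₁ s₀ = U₂ s₀ → ∀ s : ℝ, s₀ ≤ s → U₁ s = U₂ s)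
    (hL : 0 < L) (hper : ∀ s y, U (s + L) y = U s y)
    (hns : ∃ (s₀ : ℝ) (y₀ : EuclideanSpace ℝ (Fin 3)), timeDerivWithin (univ : Set ℝ) U s₀ y₀ ≠ 0) :
    ∀ s : ℝ, ∃ y : EuclideanSpace ℝ (Fin 3), timeDerivWithin (univ : Set ℝ) U s y ≠ 0 := by
  by_contra hcon
  push Not at hcon
  obtain ⟨sstar, hst⟩ := hcon
  obtain ⟨s₀, y₀, hy₀⟩ := hns
  -- the steady member through the slice `s⋆`
  have hconst := const_mem_of_stationary_slice (U := U) (P := P) hLB hst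
  have hfwd : ∀ s : ℝ, sstar ≤ s → U s = U sstar := fun s hs =>
    huniq U P (fun _ => U sstar) (fun _ => P sstar) hLB hconst sstar rfl s hs
  -- periodicity propagates the steadiness to all `s`
  have hperU : ∀ (n : ℕ) (s : ℝ), U (s + n * L) = U s := by
    intro n
    induction n with
    | zero => intro s; simp
    | succ n ih =>
      intro s
      have e : s + ((n + 1 : ℕ) : ℝ) * L = (s + n * L) + L := by push_cast; ring
      rw [e]
      exact (funext fun y => hper (s + n * L) y).trans (ih s)
  have hall : ∀ s : ℝ, U s = U sstar := by
    intro s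
    obtain ⟨n, hn⟩ := exists_nat_gt ((sstar - s) / L)
    have hs : sstar ≤ s + n * L := by
      have := (div_lt_iff₀ hL).1 hn
      linarith
    rw [← hperU n s]
    exact hfwd _ hs
  -- hence `∂ₛU ≡ 0`, contradicting non-steadiness at `(s₀, y₀)`
  have hfun : (fun σ => U σ y₀) = fun _ => U sstar y₀ := funext fun σ => by rw [hall σ]
  apply hy₀
  simp only [timeDerivWithin_apply, hfun, derivWithin_fun_const, Pi.zero_apply]

/-- **The registered statement of `stub_oneGoodSlice` is FALSE in the lead's periodic world, given
forward uniqueness in `LB(C, K)`.**  World hypothesis verbatim as in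
`not_finiteGaussianActionStatement_of_periodic_world` (one `L`-periodic non-steady profile in
`LB(C, K)`); the extra input, forward uniqueness of classical trajectories in `LB(C, K)`, is known
mathematics (bounded classical solutions decaying at infinity have the Riesz pressure gradient, are
mild, and bounded mild solutions are unique) not yet in the tree, so it is stated inline.  Together with
the lead's file: in that world ALL THREE registered strengths of the bet fail.
[cite: ChaeWolf2017RemovingDSS, Thm 1.3 and §4] -/
theorem not_oneGoodSliceStatement_of_periodic_world
    (hworld : ∃ (C K L : ℝ) (U : ℝ → EuclideanSpace ℝ (Fin 3) → EuclideanSpace ℝ (Fin 3)) (P : ℝ → EuclideanSpace ℝ (Fin 3) → ℝ),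
      (Literature.Analysis.FluidPDE.IsBackwardLeraySolutionOn (Set.univ : Set ℝ) 1 U P ∧ ∀ (s : ℝ) (y : EuclideanSpace ℝ (Fin 3)), (1 + ‖y‖) * ‖U s y‖ ≤ C ∧ (1 + ‖y‖) ^ 2 * ‖fderiv ℝ (U s) y‖ ≤ K ∧ (1 + ‖y‖) ^ 3 * ‖iteratedFDeriv ℝ 2 (U s) y‖ ≤ K ∧ (1 + ‖y‖) ^ 2 * |P s y| ≤ K ∧ (1 + ‖y‖) ^ 3 * ‖gradient (P s) y‖ ≤ K ∧ (1 + ‖y‖) * ‖Literature.Analysis.FluidPDE.timeDerivWithin (Set.univ : Set ℝ) U s y‖ ≤ K ∧ (1 + ‖y‖) ^ 2 * ‖fderiv ℝ (fun z => Literature.Analysis.FluidPDE.timeDerivWithin (Set.univ : Set ℝ) U s z) y‖ ≤ K ∧ (1 + ‖y‖) ^ 3 * ‖Literature.Analysis.FluidPDE.timeDerivWithin (Set.univ : Set ℝ) U s y + (1 / 2 : ℝ) • U s y + (1 / 2 : ℝ) • fderiv ℝ (U s) y y‖ ≤ K) ∧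
      0 < L ∧ (∀ s y, U (s + L) y = U s y) ∧
      (∃ (s₀ : ℝ) (y₀ : EuclideanSpace ℝ (Fin 3)), timeDerivWithin (univ : Set ℝ) U s₀ y₀ ≠ 0) ∧
      ∀ (U₁ : ℝ → EuclideanSpace ℝ (Fin 3) → EuclideanSpace ℝ (Fin 3)) (P₁ : ℝ → EuclideanSpace ℝ (Fin 3) → ℝ)
        (U₂ : ℝ → EuclideanSpace ℝ (Fin 3) → EuclideanSpace ℝ (Fin 3)) (P₂ : ℝ → EuclideanSpace ℝ (Fin 3) → ℝ),
        (Literature.Analysis.FluidPDE.IsBackwardLeraySolutionOn (Set.univ : Set ℝ) 1 U₁ P₁ ∧ ∀ (s : ℝ) (y : EuclideanSpace ℝ (Fin 3)), (1 + ‖y‖) * ‖U₁ s y‖ ≤ C ∧ (1 + ‖y‖) ^ 2 * ‖fderiv ℝ (U₁ s) y‖ ≤ K ∧ (1 + ‖y‖) ^ 3 * ‖iteratedFDeriv ℝ 2 (U₁ s) y‖ ≤ K ∧ (1 + ‖y‖) ^ 2 * |P₁ s y| ≤ K ∧ (1 + ‖y‖) ^ 3 * ‖gradient (P₁ s) y‖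 ≤ K ∧ (1 + ‖y‖) * ‖Literature.Analysis.FluidPDE.timeDerivWithin (Set.univ : Set ℝ) U₁ s y‖ ≤ K ∧ (1 + ‖y‖) ^ 2 * ‖fderiv ℝ (fun z => Literature.Analysis.FluidPDE.timeDerivWithin (Set.univ : Set ℝ) U₁ s z) y‖ ≤ K ∧ (1 + ‖y‖) ^ 3 * ‖Literature.Analysis.FluidPDE.timeDerivWithin (Set.univ : Set ℝ) U₁ s y + (1 / 2 : ℝ) • U₁ s y + (1 / 2 : ℝ) • fderiv ℝ (U₁ s) y y‖ ≤ K) → (Literature.Analysis.FluidPDE.IsBackwardLeraySolutionOn (Set.univ : Set ℝ) 1 U₂ P₂ ∧ ∀ (s : ℝ) (y : EuclideanSpace ℝ (Fin 3)), (1 + ‖y‖) * ‖U₂ s y‖ ≤ C ∧ (1 + ‖y‖) ^ 2 * ‖fderiv ℝ (U₂ s) y‖ ≤ K ∧ (1 + ‖y‖) ^ 3 * ‖iteratedFDeriv ℝ 2 (U₂ s) y‖ ≤ K ∧ (1 + ‖y‖) ^ 2 * |P₂ s y| ≤ K ∧ (1 + ‖y‖) ^ 3 * ‖gradient (P₂ s)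 y‖ ≤ K ∧ (1 + ‖y‖) * ‖Literature.Analysis.FluidPDE.timeDerivWithin (Set.univ : Set ℝ) U₂ s y‖ ≤ K ∧ (1 + ‖y‖) ^ 2 * ‖fderiv ℝ (fun z => Literature.Analysis.FluidPDE.timeDerivWithin (Set.univ : Set ℝ) U₂ s z) y‖ ≤ K ∧ (1 + ‖y‖) ^ 3 * ‖Literature.Analysis.FluidPDE.timeDerivWithin (Set.univ : Set ℝ) U₂ s y + (1 / 2 : ℝ) • U₂ s y + (1 / 2 : ℝ) • fderiv ℝ (U₂ s) y y‖ ≤ K) → ∀ s₀ : ℝ, U₁ s₀ = U₂ s₀ → ∀ s : ℝ, s₀ ≤ s → U₁ s = U₂ s) :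
    ¬ (∀ (C K : ℝ) (U : ℝ → EuclideanSpace ℝ (Fin 3) → EuclideanSpace ℝ (Fin 3)) (P : ℝ → EuclideanSpace ℝ (Fin 3) → ℝ), (Literature.Analysis.FluidPDE.IsBackwardLeraySolutionOn (Set.univ : Set ℝ) 1 U P ∧ ∀ (s : ℝ) (y : EuclideanSpace ℝ (Fin 3)), (1 + ‖y‖) * ‖U s y‖ ≤ C ∧ (1 + ‖y‖) ^ 2 * ‖fderiv ℝ (U s) y‖ ≤ K ∧ (1 + ‖y‖) ^ 3 * ‖iteratedFDeriv ℝ 2 (U s) y‖ ≤ K ∧ (1 + ‖y‖) ^ 2 * |P s y| ≤ K ∧ (1 + ‖y‖) ^ 3 * ‖gradient (P s) y‖ ≤ K ∧ (1 + ‖y‖) * ‖Literature.Analysis.FluidPDE.timeDerivWithin (Set.univ : Set ℝ) U s y‖ ≤ K ∧ (1 + ‖y‖) ^ 2 * ‖fderiv ℝ (fun z => Literature.Analysis.FluidPDE.timeDerivWithin (Set.univ : Set ℝ) U s z) y‖ ≤ K ∧ (1 + ‖y‖) ^ 3 * ‖Literature.Analysis.FluidPDE.timeDerivWithin (Set.univ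 : Set ℝ) U s y + (1 / 2 : ℝ) • U s y + (1 / 2 : ℝ) • fderiv ℝ (U s) y y‖ ≤ K) → ∀ δ : ℝ, 0 < δ → ∀ R : ℝ, 0 < R → (∃ sbar : ℝ, ∀ y : EuclideanSpace ℝ (Fin 3), ‖y‖ < R → ‖Literature.Analysis.FluidPDE.timeDerivWithin (Set.univ : Set ℝ) U sbar y‖ ≤ δ)) := by
  intro hstub
  obtain ⟨C, K, L, U, P, hLB, hL, hper, hns, huniq⟩ := hworld
  exact not_oneGoodSlice_of_periodic hLB.1 hL hper
    (forall_exists_timeDerivWithin_ne_zero_of_forwardUnique hLB huniq hL hper hns) (hstub C K U P hLB)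

end Summit.NavierStokesRegularity.NavierStokesRegularity.Theorems.SymmetricScarExists.Negative

end
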